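import Summits.Ventures.PercRepro.MSTightTighteningAlpha
import Summits.Ventures.PercRepro.MSTightTwinFreeProduct

/-!
# Conjecture (T), case (α): at a tightening direction with a tight partner family, `Y ⊆ X`

Dossier proofs/MINE1-theoremS.md, Addendum 45. Setting: `F` a family, `r` an element with
`P = proj r F` tight and twin-free, `K = partner r F` tight and nonempty, and `X ∩ Y = K ∖∖ K ⊔ {e}`
for one extra difference `e ∉ K ∖∖ K` (case (α) of the excess split `tightening_split` of an
excess-one family). Then every type-I difference `z = t ∖ s` (`t ∈ F₁`, `s ∈ F₀`) is an `r`-free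
difference: **`Y ⊆ X`** (`diffsY_subset_diffsX_of_tight_partner`), hence `X = D(P)` and
`|Y| = |K| + 1`.

The proof. Fix `z = t ∖ s ∉ X`. Two realisation lemmas on the tight twin-free trace `P`
(`mem_iff_parts`, `isDownSet_diffs_of_twinFree`, with `R_P = Rstar P`):
* every member `a ⊇ z` of `P` lying in `F₀` puts `z` into `X` — `b := (a ∪ R_P) ∖ z` is a member
  of `P` with `a ∖ b = z` (`sdiff_mem_diffsX_of_superset_mem_part0`);
* every member `b` of `P` disjoint from `z` lying in `F₁` puts `z` into `X` —
  `a := z ∪ (b ∩ R_P)` is a member of `P` with `a ∖ b = z` (`sdiff_mem_diffsX_of_disjoint_mem_partr`).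
With `R = Rstar K ∈ K`: if `t ∖ R ≠ e` then `t ∪ R ∈ K ⊆ F₀` (`union_Rstar_mem_partner_of_ne`) is a
member of `P` containing `z` — impossible; so `t ∖ R = e`. If `R ∖ s ≠ e` then `s ∩ R ∈ K ⊆ F₁`
(`inter_Rstar_mem_partner_of_ne`) is a member of `P` disjoint from `z` — impossible; so
`R ∖ s = e`. Then `e = t ∖ R` avoids `R` and `e = R ∖ s` lies inside `R`, so `e = ∅ ∈ K ∖∖ K`,
against `e ∉ K ∖∖ K`.
-/

namespace PercRepro.MSTight

open Finset
open scoped FinsetFamily symmDiff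

variable {α : Type*} [DecidableEq α] [Fintype α] {r : α} {F : Finset (Finset α)}

section Realisation

variable (hP : Tight (proj r F)) (htf : ∀ a b, Twin (proj r F) a b → a = b)
include hP htf

omit [Fintype α] hP htf in
/-- `Y ⊆ D(P)`. -/
theorem diffsY_subset_diffs_proj' : diffsY r F ⊆ proj r F \\ proj r F := by
  rw [diffs_proj_eq]; exact subset_union_right

/-- **Realisation from above.** A member `a ∈ F₀` of the trace containing the type-I difference
`z = t ∖ s` puts `z` into `X`: `b := (a ∪ R_P) ∖ z` is a member of the trace with `a ∖ b = z`. -/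
theorem sdiff_mem_diffsX_of_superset_mem_part0 {z : Finset α} (hz : z ∈ diffsY r F)
    {a : Finset α} (ha : a ∈ part0 r F) (hza : z ⊆ a) : z ∈ diffsX r F := by
  have hD : IsDownSet (proj r F \\ proj r F) := isDownSet_diffs_of_twinFree hP htf
  have hzD : z ∈ proj r F \\ proj r F := diffsY_subset_diffs_proj' hz
  have haP : a ∈ proj r F := by rw [proj_eq_union]; exact mem_union_left _ ha
  set RP := Rstar (proj r F) with hRP
  obtain ⟨ha1, _⟩ := (mem_iff_parts hP).1 haP
  -- the partner realisation `b`
  set b := (a ∪ RP) \ z with hb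
  have hbP : b ∈ proj r F := by
    rw [mem_iff_parts hP]
    constructor
    · refine hD _ ha1 _ ?_
      intro x hx
      simp only [hb, mem_sdiff, mem_union] at hx
      simp only [mem_sdiff]
      tauto
    · refine hD _ hzD _ ?_
      intro x hx
      simp only [hb, mem_sdiff, mem_union, not_and, not_not] at hx
      exact hx.2 (Or.inr hx.1)
  have hab : a \ b = z := by
    ext x
    simp only [hb, mem_sdiff, mem_union, not_and, not_not]
    constructor
    · rintro ⟨hxa, h⟩; exact h (Or.inl hxa)
    · intro hxz; exact ⟨hza hxz, fun _ => hxz⟩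
  rw [proj_eq_union, mem_union] at hbP
  rcases hbP with hb0 | hb1
  · exact mem_union.2 (Or.inl (mem_union.2 (Or.inl (hab ▸ mem_diffs.2 ⟨a, ha, b, hb0, rfl⟩))))
  · exact mem_union.2 (Or.inr (hab ▸ mem_diffs.2 ⟨a, ha, b, hb1, rfl⟩))

/-- **Realisation from below.** A member `b ∈ F₁` of the trace disjoint from the type-I difference
`z = t ∖ s` puts `z` into `X`: `a := z ∪ (b ∩ R_P)` is a member of the trace with `a ∖ b = z`. -/
theorem sdiff_mem_diffsX_of_disjoint_mem_partr {z : Finset α} (hz : z ∈ diffsY r F)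
    {b : Finset α} (hb : b ∈ partr r F) (hzb : Disjoint z b) : z ∈ diffsX r F := by
  have hD : IsDownSet (proj r F \\ proj r F) := isDownSet_diffs_of_twinFree hP htf
  have hzD : z ∈ proj r F \\ proj r F := diffsY_subset_diffs_proj' hz
  have hbP : b ∈ proj r F := by rw [proj_eq_union]; exact mem_union_right _ hb
  set RP := Rstar (proj r F) with hRP
  obtain ⟨_, hb2⟩ := (mem_iff_parts hP).1 hbP
  set a := z ∪ (b ∩ RP) with ha
  have haP : a ∈ proj r F := by
    rw [mem_iff_parts hP]
    constructor
    · refine hD _ hzD _ ?_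
      intro x hx
      simp only [ha, mem_sdiff, mem_union, mem_inter] at hx
      tauto
    · refine hD _ hb2 _ ?_
      intro x hx
      rw [mem_sdiff] at hx ⊢
      refine ⟨hx.1, fun hxb => hx.2 ?_⟩
      simp only [ha, mem_union, mem_inter]
      exact Or.inr ⟨hxb, hx.1⟩
  have hab : a \ b = z := by
    ext x
    simp only [ha, mem_sdiff, mem_union, mem_inter]
    constructor
    · rintro ⟨h1 | ⟨h1, _⟩, h2⟩
      · exact h1
      · exact absurd h1 h2
    · intro hxz
      exact ⟨Or.inl hxz, fun hxb => (Finset.disjoint_left.1 hzb) hxz hxb⟩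
  rw [proj_eq_union, mem_union] at haP
  rcases haP with ha0 | ha1
  · exact mem_union.2 (Or.inr (hab ▸ mem_diffs.2 ⟨a, ha0, b, hb, rfl⟩))
  · exact mem_union.2 (Or.inl (mem_union.2 (Or.inr (hab ▸ mem_diffs.2 ⟨a, ha1, b, hb, rfl⟩))))

end Realisation

section AlphaT

variable (hP : Tight (proj r F)) (htf : ∀ a b, Twin (proj r F) a b → a = b)
  (hT : Tight (partner r F)) (hK : (partner r F).Nonempty) {e : Finset α}
  (he : e ∉ partner r F \\ partner r F)
  (hXY : diffsX r F ∩ diffsY r F = insert e (partner r F \\ partner r F))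
include hP htf hT hK he hXY

/-- **Conjecture (T), case (α).** At a tightening direction `r` of a family whose trace is tight
and twin-free, if the partner family `K` is tight and nonempty and `X ∩ Y = K ∖∖ K ⊔ {e}`, then
every type-I difference is an `r`-free difference: `Y ⊆ X`. -/
theorem diffsY_subset_diffsX_of_tight_partner : diffsY r F ⊆ diffsX r F := by
  intro z hz
  by_contra hzX
  obtain ⟨t, ht, s, hs, rfl⟩ := mem_diffs.1 hz
  set R := Rstar (partner r F) with hR
  have hRK : R ∈ partner r F := Rstar_mem_partner_of_tight hT hK
  -- (1) `t ∖ R = e`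
  have h1 : t \ R = e := by
    by_contra hne
    have hk : t ∪ R ∈ partner r F := union_Rstar_mem_partner_of_ne hT hK hXY ht hne
    exact hzX (sdiff_mem_diffsX_of_superset_mem_part0 hP htf hz (mem_inter.1 hk).1
      (sdiff_subset.trans subset_union_left))
  -- (2) `R ∖ s = e`
  have h2 : R \ s = e := by
    by_contra hne
    have hk : s ∩ R ∈ partner r F := inter_Rstar_mem_partner_of_ne hT hK hXY hs hne
    refine hzX (sdiff_mem_diffsX_of_disjoint_mem_partr hP htf hz (mem_inter.1 hk).2 ?_)
    rw [Finset.disjoint_left]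
    intro x hx hx'
    exact (mem_sdiff.1 hx).2 (mem_inter.1 hx').1
  -- (3) `e = ∅ ∈ K ∖∖ K`
  have h3 : e = ∅ := by
    ext x
    simp only [Finset.notMem_empty, iff_false]
    intro hx
    have hx1 := mem_sdiff.1 (h1 ▸ hx)
    have hx2 := mem_sdiff.1 (h2 ▸ hx)
    exact hx1.2 hx2.1
  obtain ⟨k, hk⟩ := hK
  exact he (h3 ▸ mem_diffs.2 ⟨k, hk, k, hk, Finset.sdiff_self k⟩)

/-- In case (α), `X = D(P)`. -/
theorem diffsX_eq_diffs_proj_of_tight_partner : diffsX r F = proj r F \\ proj r F := by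
  rw [diffs_proj_eq]
  exact (union_eq_left.2 (diffsY_subset_diffsX_of_tight_partner hP htf hT hK he hXY)).symm

/-- In case (α), `|Y| = |K| + 1`. -/
theorem card_diffsY_of_tight_partner : (diffsY r F).card = (partner r F).card + 1 := by
  have h := diffsY_subset_diffsX_of_tight_partner hP htf hT hK he hXY
  have hY : diffsX r F ∩ diffsY r F = diffsY r F := inter_eq_right.2 h
  rw [← hY, hXY, card_insert_of_notMem he, hT]

end AlphaT

end PercRepro.MSTight
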